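import Summits.CriticalPhenomena.PercolationContinuityZ3.Theorems.FK.PartitionFunctionSeams
import Literature.Probability.LatticeModels.RandomClusterEmbedding
import Literature.Probability.LatticeModels.RandomClusterShiftedBoxes
import HarnessLib

/-!
# FK-continuity cell, FO-10a (pressure layer, file 2): `|log Z⁰_Λ - log Z⁰_{Λ₁} - log Z⁰_{Λ ∖ Λ₁}| ≤ |∂ᵉΛ₁| log q` for the
# finite pieces of a locally finite graph, its iteration over a partition, and translation invariance on `ℤ^d`

Registered R83 (cell INBOX l.6084, 2026-08-24); registry row FO-10a-g338; label PRS-B (coordinator fk-4 g187).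
Cell `fk-continuity` (bschramm), row FO-10a (domain-Markov + comparison layer over FO-06); support file for the
FK-continuity transplant (`--supports stmt-CriticalPhenomena-4575`); builds on p205010 (kernel theorem, internal audit
signed; external expert review pending). Pure proofs; no definitions, no named facts, no sorries; arbitrary locally finite
graphs (translation invariance: `ℤ^d`, general `d`). UNCONDITIONAL finite-volume structure — the input of the thermodynamic
limit of the pressure (Grimmett 2006, Thm. (4.58)); it decides nothing about FH / TP_FK / the value of `p_c(q)`.

For `q ≥ 1`, `0 ≤ p ≤ 1`, a locally finite graph `G` and finite vertex sets `Λ₁ ⊆ Λ`, with `Z⁰_Λ = rcPartitionFunction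
(finsetGraph G Λ) p q ∅` the free partition function of the piece `(Λ, E_Λ)`:

* `map_finsetGraph_le`, `coe_mem_of_mem_edgeFinset_map_finsetGraph`, `natCard_notMem_range_impEmbedding`,
  `rcPartitionFunction_map_finsetGraph` (`Z⁰` of `(Λ₁, E_{Λ₁})` seen inside `Λ` is `Z⁰_{Λ₁} q^{|Λ ∖ Λ₁|}`, by Literature
  `rcPartitionFunction_map_image`), `card_seam_le_card_edgeBoundary` (the seam edges are boundary edges of `Λ₁`);
* **`rcPartitionFunction_finsetGraph_le_mul`**, **`mul_le_pow_mul_rcPartitionFunction_finsetGraph`**,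
  **`abs_log_rcPartitionFunction_finsetGraph_sub_add_le`** — Grimmett 2006, Thm. (3.63) for finite pieces:
  `Z⁰_Λ ≤ Z⁰_{Λ₁} Z⁰_{Λ∖Λ₁} ≤ q^{|∂ᵉΛ₁|} Z⁰_Λ`, i.e. `|log Z⁰_Λ - (log Z⁰_{Λ₁} + log Z⁰_{Λ∖Λ₁})| ≤ |∂ᵉΛ₁| log q`;
  `abs_log_rcPartitionFunction_finsetGraph_union_le`, `rcPartitionFunction_finsetGraph_empty`,
  `log_rcPartitionFunction_finsetGraph_mem_Icc` (`0 ≤ log Z^B_Λ ≤ |Λ| log q`),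
  **`abs_log_rcPartitionFunction_finsetGraph_biUnion_sub_sum_le`** (iteration over a finite partition — the form used in the
  proof of Thm. (4.58), eq. (4.65));
* `rcPartitionFunction_finsetGraph_eq_of_iso`, **`rcPartitionFunction_finsetGraph_map_shift`** — automorphism and translation
  invariance, `Z⁰_{Λ + a} = Z⁰_Λ` on `ℤ^d` (Grimmett 2006, proof of Thm. (4.58): "by the translation-invariance of `Z_Λ(p,q)`").

Honest framing: finite-volume identities and inequalities; no statement about `p_c(q)`; NOT a binder discharge, NOT `_r4`.

## References

* G. Grimmett, *The Random-Cluster Model*, Springer 2006 (`book:grimmett2006-random-cluster-model`): §3.6 (3.62), Thm. (3.63)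
  [PDF pp. 56–57]; §4.3 (automorphism invariance); §4.5, proof of Thm. (4.58), (4.65) [PDF pp. 90–92]. [Grimmett2006]
-/

noncomputable section

open Finset SimpleGraph

namespace Summit.CriticalPhenomena.PercolationContinuityZ3.Theorems.FK

open Literature.Probability.Percolation Literature.Probability.LatticeModels

/-! ### Finite pieces of a locally finite graph: `|log Z⁰_Λ - log Z⁰_{Λ₁} - log Z⁰_{Λ ∖ Λ₁}| ≤ |∂ᵉΛ₁| log q` -/

section Region

variable {V : Type*} [DecidableEq V] (G : SimpleGraph V) [DecidableRel G.Adj] {Λ₁ Λ : Finset V}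

omit [DecidableEq V] [DecidableRel G.Adj] in
/-- The piece `(Λ₁, E_{Λ₁})` seen inside `(Λ, E_Λ)` along the inclusion `Λ₁ ↪ Λ` is a subgraph.
[cite: Grimmett2006, §4.2 (E_Λ)] -/
theorem map_finsetGraph_le (hsub : Λ₁ ⊆ Λ) :
    (finsetGraph G Λ₁).map (Subtype.impEmbedding (· ∈ Λ₁) (· ∈ Λ) hsub) ≤ finsetGraph G Λ := by
  intro u v huv
  rw [SimpleGraph.map_adj] at huv
  obtain ⟨u', v', hadj, rfl, rfl⟩ := huv
  exact hadj

/-- The edges of the piece `(Λ₁, E_{Λ₁})` seen inside `(Λ, E_Λ)` have their endpoints in `Λ₁`.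
[cite: Grimmett2006, §4.2 (E_Λ)] -/
theorem coe_mem_of_mem_edgeFinset_map_finsetGraph (hsub : Λ₁ ⊆ Λ) {e : Sym2 ↥Λ}
    (he : e ∈ ((finsetGraph G Λ₁).map (Subtype.impEmbedding (· ∈ Λ₁) (· ∈ Λ) hsub)).edgeFinset) :
    ∀ x ∈ e, x.1 ∈ Λ₁ := by
  rw [SimpleGraph.edgeFinset_map, Finset.mem_map] at he
  obtain ⟨e', -, rfl⟩ := he
  intro x hx
  rw [Function.Embedding.sym2Map_apply, Sym2.mem_map] at hx
  obtain ⟨y, -, rfl⟩ := hx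
  exact y.2

/-- The idle vertices of `Λ₁ ↪ Λ` are those of `Λ ∖ Λ₁`. [folklore] -/
theorem natCard_notMem_range_impEmbedding (hsub : Λ₁ ⊆ Λ) :
    Nat.card {u : ↥Λ // u ∉ Set.range (Subtype.impEmbedding (· ∈ Λ₁) (· ∈ Λ) hsub)} = #(Λ \ Λ₁) := by
  rw [← Fintype.card_coe (Λ \ Λ₁), ← Nat.card_eq_fintype_card]
  refine Nat.card_congr
    { toFun := fun u => ⟨u.1.1, Finset.mem_sdiff.2 ⟨u.1.2, fun h => u.2 ⟨⟨u.1.1, h⟩, Subtype.ext rfl⟩⟩⟩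
      invFun := fun x => ⟨⟨x.1, (Finset.mem_sdiff.1 x.2).1⟩, ?_⟩
      left_inv := fun u => Subtype.ext (Subtype.ext rfl)
      right_inv := fun x => Subtype.ext rfl }
  rintro ⟨y, hy⟩
  have hy' : y.1 = x.1 := congrArg Subtype.val hy
  exact (Finset.mem_sdiff.1 x.2).2 (hy' ▸ y.2)

/-- **The piece seen inside the bigger piece has the same free partition function up to `q^{#idle}`**:
`Z⁰_{(Λ₁,E_{Λ₁}) ↪ Λ} = Z⁰_{Λ₁} q^{|Λ ∖ Λ₁|}`. [cite: Grimmett2006, §1.2 eq. (1.3)] -/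
theorem rcPartitionFunction_map_finsetGraph (hsub : Λ₁ ⊆ Λ) (p q : ℝ) :
    rcPartitionFunction ((finsetGraph G Λ₁).map (Subtype.impEmbedding (· ∈ Λ₁) (· ∈ Λ) hsub)) p q ∅ =
      rcPartitionFunction (finsetGraph G Λ₁) p q ∅ * q ^ #(Λ \ Λ₁) := by
  have h := rcPartitionFunction_map_image (Subtype.impEmbedding (· ∈ Λ₁) (· ∈ Λ) hsub)
    (G := finsetGraph G Λ₁) (G' := (finsetGraph G Λ₁).map (Subtype.impEmbedding (· ∈ Λ₁) (· ∈ Λ) hsub))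
    (SimpleGraph.edgeFinset_map _ _) p q ∅
  rw [Set.image_empty, natCard_notMem_range_impEmbedding] at h
  exact h

/-- **Grimmett 2006, Thm. (3.63), upper bound, for the finite pieces of a locally finite graph** (`q ≥ 1`, free
boundary conditions): for `Λ₁ ⊆ Λ`, `Z⁰_Λ ≤ Z⁰_{Λ₁} · Z⁰_{Λ ∖ Λ₁}`.
[cite: Grimmett2006, Thm. (3.63) (Z_G ≤ Z_{G₁} Z_{G₂} (1 ∧ q)^{-|F|})] -/
theorem rcPartitionFunction_finsetGraph_le_mul {p q : ℝ} (hp : p ∈ Set.Icc (0 : ℝ) 1) (hq : 1 ≤ q)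
    (hsub : Λ₁ ⊆ Λ) :
    rcPartitionFunction (finsetGraph G Λ) p q ∅ ≤
      rcPartitionFunction (finsetGraph G Λ₁) p q ∅ * rcPartitionFunction (finsetGraph G (Λ \ Λ₁)) p q ∅ := by
  have hsub₂ : Λ \ Λ₁ ⊆ Λ := Finset.sdiff_subset
  have key := rcPartitionFunction_mul_pow_card_le_mul (finsetGraph G Λ)
    ((finsetGraph G Λ₁).map (Subtype.impEmbedding (· ∈ Λ₁) (· ∈ Λ) hsub))
    ((finsetGraph G (Λ \ Λ₁)).map (Subtype.impEmbedding (· ∈ Λ \ Λ₁) (· ∈ Λ) (fun _ h => (Finset.mem_sdiff.1 h).1)))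
    {u : ↥Λ | u.1 ∈ Λ₁} hp hq (map_finsetGraph_le G hsub) (map_finsetGraph_le G hsub₂)
    (fun e he x hx => coe_mem_of_mem_edgeFinset_map_finsetGraph G hsub he x hx)
    (fun e he x hx => (Finset.mem_sdiff.1 (coe_mem_of_mem_edgeFinset_map_finsetGraph G hsub₂ he x hx)).2)
  rw [rcPartitionFunction_map_finsetGraph G hsub, rcPartitionFunction_map_finsetGraph G hsub₂,
    Finset.sdiff_sdiff_eq_self hsub, Fintype.card_coe] at key
  have hcard : #(Λ \ Λ₁) + #Λ₁ = #Λ := by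
    rw [Finset.card_sdiff_of_subset hsub]
    have := Finset.card_le_card hsub
    omega
  have hqpos : 0 < q ^ #Λ := pow_pos (one_pos.trans_le hq) _
  refine le_of_mul_le_mul_right (key.trans_eq ?_) hqpos
  rw [← hcard, pow_add]
  ring

variable [G.LocallyFinite]

/-- **The seam edges are boundary edges of `Λ₁`**: an edge of `(Λ, E_Λ)` lying neither in the image of
`E_{Λ₁}` nor in that of `E_{Λ ∖ Λ₁}` has one endpoint in `Λ₁` and one outside, so the number of seam edges
is at most `|∂ᵉΛ₁|` (Grimmett's `F`, with `|F| ≤` the boundary size). [cite: Grimmett2006, Thm. (3.63) and (4.65)] -/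
theorem card_seam_le_card_edgeBoundary (hsub : Λ₁ ⊆ Λ) :
    #((finsetGraph G Λ).edgeFinset \
        (((finsetGraph G Λ₁).map (Subtype.impEmbedding (· ∈ Λ₁) (· ∈ Λ) hsub)).edgeFinset ∪
          ((finsetGraph G (Λ \ Λ₁)).map
            (Subtype.impEmbedding (· ∈ Λ \ Λ₁) (· ∈ Λ) (fun _ h => (Finset.mem_sdiff.1 h).1))).edgeFinset)) ≤
      #(edgeBoundary G Λ₁) := by
  refine Finset.card_le_card_of_injOn (fun e => Sym2.map Subtype.val e) (fun e he => ?_)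
    (fun e₁ _ e₂ _ h => Sym2.map.injective Subtype.val_injective h)
  rw [Finset.mem_coe, Finset.mem_sdiff, Finset.mem_union, not_or] at he
  obtain ⟨he, he₁, he₂⟩ := he
  rw [Finset.mem_coe]
  induction e using Sym2.ind with
  | h u v =>
    rw [SimpleGraph.mem_edgeFinset, SimpleGraph.mem_edgeSet] at he
    have hG : G.Adj u.1 v.1 := he
    show Sym2.map Subtype.val s(u, v) ∈ edgeBoundary G Λ₁
    rw [Sym2.map_mk, mem_edgeBoundary_iff]
    by_cases hu : u.1 ∈ Λ₁ <;> by_cases hv : v.1 ∈ Λ₁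
    · exfalso
      apply he₁
      rw [SimpleGraph.mem_edgeFinset, SimpleGraph.mem_edgeSet, SimpleGraph.map_adj]
      exact ⟨⟨u.1, hu⟩, ⟨v.1, hv⟩, hG, Subtype.ext rfl, Subtype.ext rfl⟩
    · exact ⟨hG, ⟨u.1, hu, Sym2.mem_mk_left _ _⟩, ⟨v.1, hv, Sym2.mem_mk_right _ _⟩⟩
    · exact ⟨hG, ⟨v.1, hv, Sym2.mem_mk_right _ _⟩, ⟨u.1, hu, Sym2.mem_mk_left _ _⟩⟩
    · exfalso
      apply he₂
      rw [SimpleGraph.mem_edgeFinset, SimpleGraph.mem_edgeSet, SimpleGraph.map_adj]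
      exact ⟨⟨u.1, Finset.mem_sdiff.2 ⟨u.2, hu⟩⟩, ⟨v.1, Finset.mem_sdiff.2 ⟨v.2, hv⟩⟩, hG,
        Subtype.ext rfl, Subtype.ext rfl⟩

/-- **Grimmett 2006, Thm. (3.63), lower bound, for the finite pieces of a locally finite graph** (`q ≥ 1`, free
boundary conditions): for `Λ₁ ⊆ Λ`, `Z⁰_{Λ₁} · Z⁰_{Λ ∖ Λ₁} ≤ q^{|∂ᵉΛ₁|} Z⁰_Λ`.
[cite: Grimmett2006, Thm. (3.63) (Z_{G₁} Z_{G₂} (1 ∨ q)^{-|F|} ≤ Z_G)] -/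
theorem mul_le_pow_mul_rcPartitionFunction_finsetGraph {p q : ℝ} (hp : p ∈ Set.Icc (0 : ℝ) 1) (hq : 1 ≤ q)
    (hsub : Λ₁ ⊆ Λ) :
    rcPartitionFunction (finsetGraph G Λ₁) p q ∅ * rcPartitionFunction (finsetGraph G (Λ \ Λ₁)) p q ∅ ≤
      q ^ #(edgeBoundary G Λ₁) * rcPartitionFunction (finsetGraph G Λ) p q ∅ := by
  have hsub₂ : Λ \ Λ₁ ⊆ Λ := Finset.sdiff_subset
  have hq0 : 0 < q := one_pos.trans_le hq
  have key := mul_le_pow_mul_rcPartitionFunction (finsetGraph G Λ)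
    ((finsetGraph G Λ₁).map (Subtype.impEmbedding (· ∈ Λ₁) (· ∈ Λ) hsub))
    ((finsetGraph G (Λ \ Λ₁)).map (Subtype.impEmbedding (· ∈ Λ \ Λ₁) (· ∈ Λ) (fun _ h => (Finset.mem_sdiff.1 h).1)))
    {u : ↥Λ | u.1 ∈ Λ₁} hp hq (map_finsetGraph_le G hsub) (map_finsetGraph_le G hsub₂)
    (fun e he x hx => coe_mem_of_mem_edgeFinset_map_finsetGraph G hsub he x hx)
    (fun e he x hx => (Finset.mem_sdiff.1 (coe_mem_of_mem_edgeFinset_map_finsetGraph G hsub₂ he x hx)).2)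
  rw [rcPartitionFunction_map_finsetGraph G hsub, rcPartitionFunction_map_finsetGraph G hsub₂,
    Finset.sdiff_sdiff_eq_self hsub, Fintype.card_coe, pow_add] at key
  have hcard : #(Λ \ Λ₁) + #Λ₁ = #Λ := by
    rw [Finset.card_sdiff_of_subset hsub]
    have := Finset.card_le_card hsub
    omega
  have hqpos : 0 < q ^ #Λ := pow_pos hq0 _
  have hZ := (rcPartitionFunction_pos (finsetGraph G Λ) hp hq0 ∅).le
  have hS := pow_le_pow_right₀ hq (card_seam_le_card_edgeBoundary G hsub)
  have key' : rcPartitionFunction (finsetGraph G Λ₁) p q ∅ * rcPartitionFunction (finsetGraph G (Λ \ Λ₁)) p q ∅ *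
      q ^ #Λ ≤ q ^ #(edgeBoundary G Λ₁) * rcPartitionFunction (finsetGraph G Λ) p q ∅ * q ^ #Λ := by
    calc _ = rcPartitionFunction (finsetGraph G Λ₁) p q ∅ * q ^ #(Λ \ Λ₁) *
          (rcPartitionFunction (finsetGraph G (Λ \ Λ₁)) p q ∅ * q ^ #Λ₁) := by rw [← hcard, pow_add]; ring
      _ ≤ _ := key
      _ ≤ q ^ #Λ * q ^ #(edgeBoundary G Λ₁) * rcPartitionFunction (finsetGraph G Λ) p q ∅ :=
          mul_le_mul_of_nonneg_right (mul_le_mul_of_nonneg_left hS (pow_nonneg hq0.le _)) hZ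
      _ = _ := by ring
  exact le_of_mul_le_mul_right key' hqpos

/-- **Near-multiplicativity of the free partition function** (Grimmett 2006, Thm. (3.63) as used in the proof of
Thm. (4.58), eq. (4.65)), logarithmic form: for `Λ₁ ⊆ Λ` and `q ≥ 1`,
`|log Z⁰_Λ - (log Z⁰_{Λ₁} + log Z⁰_{Λ ∖ Λ₁})| ≤ |∂ᵉΛ₁| log q`.
[cite: Grimmett2006, Thm. (3.63) and proof of Thm. (4.58), (4.65)] -/
theorem abs_log_rcPartitionFunction_finsetGraph_sub_add_le {p q : ℝ} (hp : p ∈ Set.Icc (0 : ℝ) 1)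
    (hq : 1 ≤ q) (hsub : Λ₁ ⊆ Λ) :
    |Real.log (rcPartitionFunction (finsetGraph G Λ) p q ∅) -
        (Real.log (rcPartitionFunction (finsetGraph G Λ₁) p q ∅) +
          Real.log (rcPartitionFunction (finsetGraph G (Λ \ Λ₁)) p q ∅))| ≤
      (#(edgeBoundary G Λ₁) : ℝ) * Real.log q := by
  have hq0 : 0 < q := one_pos.trans_le hq
  have hZ := rcPartitionFunction_pos (finsetGraph G Λ) hp hq0 ∅
  have hZ₁ := rcPartitionFunction_pos (finsetGraph G Λ₁) hp hq0 ∅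
  have hZ₂ := rcPartitionFunction_pos (finsetGraph G (Λ \ Λ₁)) hp hq0 ∅
  have hup := Real.log_le_log hZ (rcPartitionFunction_finsetGraph_le_mul G hp hq hsub)
  have hlo := Real.log_le_log (mul_pos hZ₁ hZ₂) (mul_le_pow_mul_rcPartitionFunction_finsetGraph G hp hq hsub)
  rw [Real.log_mul hZ₁.ne' hZ₂.ne'] at hup hlo
  rw [Real.log_mul (pow_pos hq0 _).ne' hZ.ne', Real.log_pow] at hlo
  have hnn : 0 ≤ (#(edgeBoundary G Λ₁) : ℝ) * Real.log q := mul_nonneg (Nat.cast_nonneg _) (Real.log_nonneg hq)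
  rw [abs_sub_le_iff]
  constructor <;> linarith

/-- The two-piece decomposition for a disjoint union `Λ₁ ∪ Λ₂`:
`|log Z⁰_{Λ₁ ∪ Λ₂} - (log Z⁰_{Λ₁} + log Z⁰_{Λ₂})| ≤ |∂ᵉΛ₁| log q`. [cite: Grimmett2006, Thm. (3.63)] -/
theorem abs_log_rcPartitionFunction_finsetGraph_union_le {p q : ℝ} (hp : p ∈ Set.Icc (0 : ℝ) 1)
    (hq : 1 ≤ q) {Λ₂ : Finset V} (hdis : Disjoint Λ₁ Λ₂) :
    |Real.log (rcPartitionFunction (finsetGraph G (Λ₁ ∪ Λ₂)) p q ∅) -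
        (Real.log (rcPartitionFunction (finsetGraph G Λ₁) p q ∅) +
          Real.log (rcPartitionFunction (finsetGraph G Λ₂) p q ∅))| ≤
      (#(edgeBoundary G Λ₁) : ℝ) * Real.log q := by
  have h := abs_log_rcPartitionFunction_finsetGraph_sub_add_le G hp hq
    (Finset.subset_union_left (s₁ := Λ₁) (s₂ := Λ₂))
  rwa [Finset.union_sdiff_cancel_left hdis] at h

omit [DecidableRel G.Adj] [G.LocallyFinite] in
/-- The empty piece has partition function `1` (no edge, no vertex, no cluster). [folklore] -/
theorem rcPartitionFunction_finsetGraph_empty [DecidableRel G.Adj] (p q : ℝ) :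
    rcPartitionFunction (finsetGraph G (∅ : Finset V)) p q ∅ = 1 := by
  have hE : (finsetGraph G (∅ : Finset V)).edgeFinset = ∅ :=
    Finset.eq_empty_of_isEmpty _
  rw [rcPartitionFunction, hE, Finset.powerset_empty, Finset.sum_singleton]
  unfold rcWeight
  rw [hE, Finset.coe_empty, clusterCount_empty_empty_eq_natCard]
  simp

omit [G.LocallyFinite] in
/-- **A priori bound for a finite piece**: `0 ≤ log Z⁰_Λ ≤ |Λ| log q` (`q ≥ 1`).
[cite: Grimmett2006, §3.6 (3.59)] -/
theorem log_rcPartitionFunction_finsetGraph_mem_Icc {p q : ℝ} (hp : p ∈ Set.Icc (0 : ℝ) 1) (hq : 1 ≤ q)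
    (Λ : Finset V) (B : Set ↥Λ) :
    Real.log (rcPartitionFunction (finsetGraph G Λ) p q B) ∈ Set.Icc 0 ((#Λ : ℝ) * Real.log q) := by
  have h := log_rcPartitionFunction_mem_Icc (finsetGraph G Λ) hp hq B
  rwa [Fintype.card_coe] at h

/-- **Decomposition of a volume into finitely many pieces** (the iteration of Grimmett 2006, Thm. (3.63)
used in the proof of Thm. (4.58), eq. (4.65): `⌊n/k⌋ [log Z_{Λ_k} - (seams) log q] + … ≤ log Z_{Λ_n} ≤ …`):
for pairwise disjoint finite pieces `T i`, `i ∈ s`, and `q ≥ 1`,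
`|log Z⁰_{⋃ᵢ T i} - ∑ᵢ log Z⁰_{T i}| ≤ (∑ᵢ |∂ᵉ(T i)|) log q`. [cite: Grimmett2006, proof of Thm. (4.58), (4.65)] -/
theorem abs_log_rcPartitionFunction_finsetGraph_biUnion_sub_sum_le {p q : ℝ} (hp : p ∈ Set.Icc (0 : ℝ) 1)
    (hq : 1 ≤ q) {ι : Type*} (s : Finset ι) (T : ι → Finset V)
    (hT : ∀ i ∈ s, ∀ j ∈ s, i ≠ j → Disjoint (T i) (T j)) :
    |Real.log (rcPartitionFunction (finsetGraph G (s.biUnion T)) p q ∅) -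
        ∑ i ∈ s, Real.log (rcPartitionFunction (finsetGraph G (T i)) p q ∅)| ≤
      (∑ i ∈ s, (#(edgeBoundary G (T i)) : ℝ)) * Real.log q := by
  classical
  induction s using Finset.induction_on with
  | empty =>
    have h := log_rcPartitionFunction_finsetGraph_mem_Icc G hp hq ((∅ : Finset ι).biUnion T) ∅
    have h0 : (#((∅ : Finset ι).biUnion T) : ℝ) * Real.log q = 0 := by simp
    rw [h0] at h
    rw [Finset.sum_empty, Finset.sum_empty, sub_zero, zero_mul, abs_of_nonneg h.1]
    exact h.2
  | insert a s ha ih =>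
    have hT' : ∀ i ∈ s, ∀ j ∈ s, i ≠ j → Disjoint (T i) (T j) := fun i hi j hj hij =>
      hT i (Finset.mem_insert_of_mem hi) j (Finset.mem_insert_of_mem hj) hij
    have hdis : Disjoint (T a) (s.biUnion T) := by
      rw [Finset.disjoint_biUnion_right]
      intro i hi
      exact hT a (Finset.mem_insert_self a s) i (Finset.mem_insert_of_mem hi)
        (fun h => ha (h ▸ hi))
    have h1 := abs_log_rcPartitionFunction_finsetGraph_union_le G hp hq hdis
    have h2 := ih hT'
    rw [Finset.biUnion_insert, Finset.sum_insert ha, Finset.sum_insert ha, add_mul]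
    calc |Real.log (rcPartitionFunction (finsetGraph G (T a ∪ s.biUnion T)) p q ∅) -
          (Real.log (rcPartitionFunction (finsetGraph G (T a)) p q ∅) +
            ∑ i ∈ s, Real.log (rcPartitionFunction (finsetGraph G (T i)) p q ∅))|
        ≤ |Real.log (rcPartitionFunction (finsetGraph G (T a ∪ s.biUnion T)) p q ∅) -
            (Real.log (rcPartitionFunction (finsetGraph G (T a)) p q ∅) +
              Real.log (rcPartitionFunction (finsetGraph G (s.biUnion T)) p q ∅))| +
          |Real.log (rcPartitionFunction (finsetGraph G (s.biUnion T)) p q ∅) -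
            ∑ i ∈ s, Real.log (rcPartitionFunction (finsetGraph G (T i)) p q ∅)| := by
          refine (abs_sub_le _ (Real.log (rcPartitionFunction (finsetGraph G (T a)) p q ∅) +
              Real.log (rcPartitionFunction (finsetGraph G (s.biUnion T)) p q ∅)) _).trans ?_
          refine add_le_add le_rfl (le_of_eq ?_)
          congr 1; ring
      _ ≤ (#(edgeBoundary G (T a)) : ℝ) * Real.log q +
            (∑ i ∈ s, (#(edgeBoundary G (T i)) : ℝ)) * Real.log q := add_le_add h1 h2

end Region

/-! ### Automorphism and translation invariance -/

section Invariance

variable {V : Type*} [DecidableEq V] {G : SimpleGraph V} [DecidableRel G.Adj]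

/-- **Automorphism invariance of the free partition function of finite pieces**: if the automorphism
`g` of `G` maps `S` onto `S'`, then `Z⁰_{S'} = Z⁰_S`. [cite: Grimmett2006, §4.3 (automorphism invariance)] -/
theorem rcPartitionFunction_finsetGraph_eq_of_iso (g : G ≃g G) {S S' : Finset V}
    (h : ∀ x, x ∈ S' ↔ g.symm x ∈ S) (p q : ℝ) :
    rcPartitionFunction (finsetGraph G S') p q ∅ = rcPartitionFunction (finsetGraph G S) p q ∅ := by
  have h' := rcPartitionFunction_relabel (finsetGraphIso g h) p q (∅ : Set ↥S)
  rwa [Set.image_empty] at h'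

/-- **Translation invariance on `ℤ^d`**: `Z⁰_{Λ + a} = Z⁰_Λ` for every finite `Λ ⊆ ℤ^d` (Grimmett 2006,
proof of Thm. (4.58): "By the translation-invariance of `Z_Λ(p,q)`, we may restrict ourselves to boxes of
this type"). [cite: Grimmett2006, proof of Thm. (4.58)] -/
theorem rcPartitionFunction_finsetGraph_map_shift {d : ℕ} (a : Site d) (Λ : Finset (Site d)) (p q : ℝ) :
    rcPartitionFunction (finsetGraph (zdGraph d) (Λ.map (Site.shift a).toEmbedding)) p q ∅ =
      rcPartitionFunction (finsetGraph (zdGraph d) Λ) p q ∅ := by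
  refine rcPartitionFunction_finsetGraph_eq_of_iso (zdShiftIso a) (fun x => ?_) p q
  rw [Finset.mem_map_equiv]
  rfl

end Invariance


end Summit.CriticalPhenomena.PercolationContinuityZ3.Theorems.FK
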